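import Mathlib
import HarnessLib
import HarnessLib.Audit
import Summits.QuantumAdvantage.Statement
import Literature.Computability.QuantumComplexity.PauliExpansion
import HarnessLib.Audit.Status.Attr

/-!
Route: XorDarkCharacters

DORMANT since 2026-08-26T14:16:46Z (reconciler: no traction for 6.7 d (last activity item-proof-filed at 2026-08-19T20:56:36Z); parked, not closed — `ledger route dormant route-QuantumAdvantage-XorDarkCharacters --off` to reactivate) — unstaffed, not closed; items shared with open routes are served there. `ledger route dormant <id> --off` reactivates.

# Route XorDarkCharacters — XOR-autocorrelation flatness of Dirichlet characters — the Gauss-sum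
witness state is Pauli-flat off explicit resonances (negative side, engine for the free-frame kills)

NEGATIVE side, Dequantize/PauliFlat/SymplecticPurity-shaped (realises card characters-are-xor-dark,
corrected at planning). THESIS X
(= item XdcThesis, the decl shared with Dequantize.DeqThesis / PauliFlat.PPThesis /
SymplecticPurity.FFThesis): every language decided
with error 1/3 by a poly-time uniform oracle-free Clifford+T family is in BPP; X → ¬QuantumAdvantage
is one line (glue `closes`,
--refutation). X is expected FALSE; the route exists for its KILLS on the hub's second live
S-witness, the Dirichlet-character state
|χ⟩ = (p−1)^(-1/2) Σ_(0<x<p) χ(x)|x⟩ of the van Dam–Seroussi / Kummer Gauss-sum algorithm (route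
KummerSector), whose Pauli spectrum is
|⟨χ|X^aZ^b|χ⟩| = (p−1)^(-1) |Σ_x χ(x)χ̄(x⊕a)(−1)^(b·x)| — XOR-AUTOCORRELATIONS of a multiplicative
character. It suffices, for the kill
"|χ⟩ is ε-flat, hence (route SymplecticPurity, crux SymplecticPurityBound) keeps Schmidt rank ≥
1/(4ε) at some bond of EVERY Clifford
frame with any stabilizer ancillas, and has stabilizer fidelity ≤ ε + 2^(−n)", to show XorCharFlat:
off the explicit RESONANT CELLS
(x⊕a ≡ −x mod p, where χ(x)χ̄(x⊕a) = χ̄(−1) is constant) every Walsh-twisted XOR-autocorrelation of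
χ saves a power p^(−δ).
Lean: `Literature.Computability.Cryptography.BQP ⊆ Literature.Computability.Complexity.BPP`

## Assembly
Pure logic: X = BQP ⊆ BPP contradicts ∃ L ∈ BQP, L ∉ BPP; `theorem closes (h0 : XdcThesis) … : ¬
QuantumAdvantage := fun ⟨L, hL, hnL⟩ => hnL (h0 hL)` (glue.lean, --refutation; every item is a
hypothesis, only h0 is used; checked sorry-free in Sketch.lean with `assembly_holds`). The cruxes
are free-standing kills and do not feed X — exactly as in Dequantize / PauliFlat / SymplecticPurity.

Rationale: WHY THIS LINE. The card's slogan "XOR cannot see characters" survives a planner audit only after two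
corrections, and the corrected statement splits
along a known barrier. (i) The card's uniform conjecture is FALSE and its "Walsh = a=0 sector" is a
slip (the a = 0 coefficients are the
Walsh spectrum of the RANGE [1,p), of size up to (2^n−p)/p): x⊕a = x + a − 2(x∧a) ≡ −x (mod p)
exactly when 2(x∧ā) ≡ −a, i.e. on ≤ 2 cells
of size ≤ 2^|a| (ResonantCells) indexed by signed-binary representations 2w − ā = kp − (2^n−1)
supported on ā = NOT a — Mersenne p at
a = 1^n (|⟨X^⊗n⟩| = 1), p = 2^n−2^j−1 (23, 223, 3583, …) at a = p (≈ 1/2); the same phenomenon the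
sibling route SymplecticPurity found
for Shor's DLOG state (NAF weight of p−1). (ii) Off resonance, Karatsuba's bilinear method as used
by Dietmann–Elsholtz–Shparlinski
(arXiv:1601.04754 Thm 16 / Lemma 2: residues with < (1/2−ε)n prescribed bits) transplants to XOR
shifts: split the bits of x into
supp(a) and its complement, x = u+v, x⊕a = (σ−u)+v, Hölder over the larger cube, Weil (Schmidt1976
Ch. II) for the moment polynomials,
degenerate tuples counted by a link graph whose cross-edges are exactly the resonance congruences —
flatness is then a THEOREM modulo
Weil for |a| ≤ (1/2−η)n and |a| ≥ (1/2+η)n (OffbandXorCharFlat), far beyond the card's c₀ ≈ 0.07.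
(iii) What is left — weight
n/2 ± ηn, i.e. almost every shift — is a bilinear multiplicative-character sum over two
complementary binary cubes of size ≈ √p:
Σ_(s∈2U+c, t∈2V+c') a_s b_t χ(t+s)χ̄(t−s), squarely at the square-root (Paley-graph / Karatsuba)
barrier, with the cube structure as the
only extra handle (Burgess–Friedlander–Iwaniec shifts for runs of consecutive bits; nothing in print
for scattered supports): the ONE
new sum (XorCharFlat, rank 2), numerically flat (max exponent 0.81 → 0.76 for n = 9 → 12, uniform in
the weight of a). Imported:
analytic number theory of digital functions (Gelfond1968, Mauduit–Rivat
doi:10.4007/annals.2010.171.1591 — CharWalshFlat, the card's T1,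
is provable NOW with the exact constant A₂ = 2cos(π/8)), bilinear character sums (Karatsuba, DES17),
Weil; the QI bridge is NOT
re-derived: CharStateFlat is typed to match SymplecticPurityBound's ε-flat hypothesis. W.r.t. prior
routes: PauliFlat (operator
y ↦ ay mod N, conjectural flatness), SymplecticPurity (S-box cube map: unconditional; DLOG state: XL
conjecture) — here a third witness
state whose flatness is a theorem off one sharply located band, with data and an explicit resonance
law.

RANKED CRUXES. #0 XdcThesis (target) — X: BQP ⊆ BPP (the shared negative-side target of Dequantize /
PauliFlat / SymplecticPurity; expected false; the route's content is the kills below). (why it might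
fail: X puts FACTORING in BPP (Shor) and contradicts the oracle evidence BQP^O ⊄ BPP^O; nobody
expects it — the route exists for the kills.) [BernsteinVazirani1997, vanDamSeroussi2002,
arXiv:2412.17209]
#2 XorCharFlat (crux) — CORRECTED CONJECTURE C' (the one new sum). ∃ δ > 0, p₀ such that for every
prime p ≥ p₀ with 2^(n−1) < p < 2^n, every nontrivial multiplicative character χ mod p, every shift
0 < a < 2^n and every Walsh mask b < 2^n: |Σ_(x<p, x⊕a<p, x+(x⊕a)≢0 (p)) χ(x) χ̄(x⊕a) (−1)^(b·x)| ≤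
p^(1−δ) — the XOR-autocorrelation of χ, twisted by any Walsh character, saves a power once the
resonant cells (x⊕a ≡ −x, summand ≡ χ̄(−1)) are removed. Off-band weights are OffbandXorCharFlat
(theorem mod Weil); the content is the MID BAND |a| = n/2 ± ηn: Σ_(s∈2U+c,t∈2V+c') a_s b_t
χ(t+s)χ̄(t−s) over complementary binary cubes U, V of size ≈ √p. [difficulty: open-problem] (why it
might fail: Mid band = square-root barrier (both cubes ≈ √p, Paley/Karatsuba range; no method in
print crosses it for cubes); and an unforeseen affine coincidence x⊕a ≡ u·x+d (u ≠ ±1) on 2^(n−o(n))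
points for structured (p,a) would refute it outright.) [DietmannElsholtzShparlinski2016,
HansonPetridis2020, arXiv:2303.16475, Schmidt1976, vanDamSeroussi2002, card
QuantumAdvantage/QuantumAdvantage/characters-are-xor-dark]
#3 OffbandXorCharFlat (crux) — The off-band theorem: for every η > 0 there are δ > 0, p₀ with the
bound of XorCharFlat for all shifts a of Hamming weight ≤ (1/2−η)n or ≥ (1/2+η)n. PROOF PLAN
(planner NOTES §6): nested dyadic decomposition of the two range conditions into O(n²) sub-cubes; in
each, x = H+u+v, x⊕a = H'+(σ−u)+v with u on supp(a), v off it; Hölder (2ν-th moment) over the cube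
of size ≥ p^(1/2+η/2), inner cube ≥ p^(η/2ν) (tiny weights: 2^|a| cells of additive-shift
correlations, Karatsuba again inside each cell); Weil for Σ_v χ(R(v)), deg R ≤ 4ν; degenerate tuples
≤ C_ν·(#U)^ν via the link graph (each variable's two roots must be matched by another variable's;
cross-matches are the resonance congruences u_i+u_j ≡ R with ≤ 3 partners); resonant x = at most 2
excluded values of v, product structure kept. THEOREM MODULO WEIL: Lean closure needs Weil's bound
for multiplicative character sums of polynomials (Schmidt1976 II.2C'), requested as Literature cite
fact wi-20042 — provers should block on that fact (blocked-on), not re-derive RH for curves here.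
[difficulty: L] (why it might fail: The planner's degenerate-tuple count (link graph incl. resonance
cross-pairings) or the nested range decomposition could leak a factor 2^Ω(n) near |a| ≈ (1/2±η)n;
δ(η) ~ η²/ν is tiny; in Lean it is hostage to Weil's bound (absent from Mathlib).)
[DietmannElsholtzShparlinski2016, Schmidt1976, IwaniecKowalski2004, Weil1948, KaratsubaVoronin1992]
#4 CharWalshFlat (crux) — Card T1 with the exact constant (PROVABLE NOW): for every prime p with
2^(n−1) < p < 2^n, nontrivial χ mod p and mask b < 2^n, |Σ_(x<p) χ(x)(−1)^(b·x)| ≤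
16·n·√p·(2+√2)^(n/4) = O(n p^(1/2+λ₂)), λ₂ = log₂(2+√2)/4 = 0.4429: every Hadamard-basis amplitude
of |χ⟩ is ≤ p^(−0.057+o(1)), i.e. the overlap of |χ⟩ with the 2^n product stabilizer states H^⊗n|b⟩
is unconditionally small (the product sector of stabilizer fidelity; the same L¹ constant covers
i^(l·x) phases). Proof: dyadic blocks of [0,p) (on a block the Walsh weight is ± a completely
2-multiplicative function of the low bits); completion χ(m) = τ(χ̄)^(−1) Σ_t χ̄(t) e(mt/p) (Mathlib
gaussSum, |τ|² = p); Gallagher's pointwise Sobolev inequality Σ_t |G(t/p)| ≤ p‖G‖₁ + ½‖G'‖₁ (FTC);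
product rule for G' (no Bernstein); L¹ block-submultiplicativity ‖Π_(j<k) 2|cos π(2^jθ+η_j)|‖₁ ≤
2·A₂^⌊k/2⌋ by θ = (m+φ)/4; A₂ := sup_η ¼Σ_(m<4) Π_(j<2) 2|cos π(2^(j−2)m+η_j)| = √(2+√2) = 2cos(π/8)
EXACTLY (fix η₀: sup_η₁ of a|cos|+b|sin| = √(a²+b²), a²+b² = 2+|sin 2πη₀|+|cos 2πη₀| ≤ 2+√2).
[difficulty: provable-now] (why it might fail: Only via the constants as typed: the Gallagher step
and the spoiled-block bound for ‖G'‖₁ are the planner's reconstruction (giving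
9·n·√p·(2+√2)^((n−1)/4); 16 is slack); the exponent is exact. Trivially true for p < 2^150, so
numerics cannot probe it.) [MauduitRivat2010, MauduitRivat2015, Gelfond1968, zbl:1026.11068,
DietmannElsholtzShparlinski2016]
#5 CharStateFlat (crux) — THE INTERFACE TO THE KILL (follows from XorCharFlat via FlatOfXorFlat;
typed to match the ε-flat hypothesis of SymplecticPurity.SymplecticPurityBound): for every θ > 0
there are δ > 0, p₀ such that for every prime p ≥ p₀ in the window 2^n − 2^((1−θ)n) ≤ p < 2^n (range
bias ≤ 2^(1−θn)) whose resonance numbers kp − (2^n−1), k = 1..5, admit NO {0,±1}-digit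
representation Σ_A 2^j − Σ_B 2^j of weight |A|+|B| < θn (off the sparse-representation locus, cf.
DlogGraphFlat's NAF hypothesis), every nontrivial χ and every Pauli string S ≠ I: |⟨ψ_χ|S|ψ_χ⟩| ≤
p^(−δ)·‖ψ_χ‖², ψ_χ(x) = χ(ofBits x)·[ofBits x < p]. Consequences by name: SymplecticPurityBound ⇒
Schmidt rank ≥ p^δ/4 at some bond of every T-free Clifford frame with stabilizer ancillas (CAMPS /
stabilizer-TN kill on the Gauss-sum witness); stabilizer fidelity ≤ p^(−δ) + 2^(−n). Honest scale:
flatness methods cap at ε ≈ 2^(−n/2) (LiuWinter §4: explicit states certified beyond that are open);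
δ here is whatever XorCharFlat gives. [deps: XorCharFlat] [difficulty: M] (why it might fail: Iff
XorCharFlat fails (mid band) or a resonance family beyond x⊕a ≡ −x exists; as typed, the pauliString
Y-phase/normSq conventions and the k ≤ 5 range of resonance numbers (a + 2w < 3·2^n < 6p) are the
planner's.) [arXiv:2412.17209, arXiv:2410.09001, BravyiEtAl2019, LiuWinter2022,
route-QuantumAdvantage-SymplecticPurity item SymplecticPurityBound, vanDamSeroussi2002]
#9 ZSectorRange (support) — The a = 0 sector is the Walsh spectrum of the range [1,p): for 0 < b <
2^n and p ≤ 2^n, |Σ_(0<x<p) (−1)^(b·x)| ≤ 2^n − p + 1 (the full cube sums to 0; the complement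
[p,2^n) and x = 0 are the error). Provable now (one line after Finset.sum over the cube); in the
window it is ≤ 2^((1−θ)n) + 1. [difficulty: provable-now] [elementary, planner NOTES.md §audit 3]
#9 ResonantCells (support) — (i) the identity x + (x⊕a) = a + 2·(x ∧ ā) for x, a < 2^n, ā =
(2^n−1)⊕a; (ii) hence the resonant x (0 < x < p, x⊕a < p, x + (x⊕a) ≡ 0 mod p) have x ∧ ā determined
mod p (≤ 2 values), so there are at most 2·2^(popcount a) of them — and each value w = x∧ā solves 2w
− ā·… i.e. is a signed-binary representation of kp − (2^n−1) supported on ā. Provable now (checked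
exhaustively for all a, p ≤ 2039). [difficulty: provable-now] [elementary, planner NOTES.md §audit
2, route-QuantumAdvantage-SymplecticPurity item DlogGraphFlat (same NAF phenomenon for g^x)]
#9 FlatOfXorFlat (support) — Glue of the interface: XorCharFlat → ZSectorRange → ResonantCells →
CharStateFlat. Proof: pauliString S|x⟩ = (phase_S(x))|x⊕a⟩ with |phase| = 1 and sign (−1)^(b·x) (b =
Z/Y positions, a = X/Y positions), so |⟨ψ|S|ψ⟩| = |Σ_x ψ(x) conj ψ(x⊕a) (−1)^(b·x)|; for a = 0 use
ZSectorRange and the window; for a ≠ 0 split off the resonant x (ResonantCells: ≤ 2·2^|a| =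
2·2^(n−|ā|) ≤ 2·2^((1−θ)n) since ā carries a signed representation of some kp − (2^n−1), hence |ā| ≥
θn by hypothesis) and bound the rest by XorCharFlat; ‖ψ‖² = p − 1. [difficulty: provable-now]
[KempeEtAl2010, AaronsonGottesman2004, planner NOTES.md §6]

TWO-LAYER PLAN. XorCharFlat ⇐ OffbandXorCharFlat → MidbandXorCharFlat → XorCharFlat (k = 2; Midband
= weights in ((1/2−η)n,(1/2+η)n), itself to be
split into 'supp(a) a union of O(1) runs of consecutive bits, b = 0' (Burgess / Friedlander–Iwaniec
shifts) and 'general').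
OffbandXorCharFlat ⇐ WeilBound (cite fact wi-20042) → KaratsubaXorCubes → OffbandXorCharFlat once
the fact lands. CharStateFlat ⇐ FlatOfXorFlat (filed).
Foreseen, NOT filed: CharStateDark for ALL large primes (stabilizer fidelity ≤ p^(−δ) without window
or sparse-representation
hypotheses: signed accounting of resonant main terms over cosets + the averaging identity Σ_(signed
reps of m) 2^(−weight) ≤ 1, planner
NOTES §audit 2 / §7, brute-forced n ≤ 8); product-stabilizer-sector fidelity ≤ p^(−0.11)
unconditionally from CharWalshFlat's method with
i^(l·x) phases; QMDD/OBDD width 2^min(k,n−k) of |χ⟩ (card P2); the vDS circuit bookkeeping (card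
K3).

KILL CRITERIA. XorCharFlat refuted by an explicit structured family (new affine coincidences on
2^(n−o(n)) points): if sparse and explicit, restate ONCE with
the enlarged resonance set; otherwise close refuted:XorCharFlat (the slogan dies; CharStateFlat dies
with it). CharStateFlat refuted directly
(a Pauli string with |⟨S⟩| ≥ p^(−o(1)) for qualifying p) → same. OffbandXorCharFlat refuted → the
planner's Karatsuba bookkeeping is wrong:
restate with the correct band (informative either way). CharWalshFlat refuted as typed → constants
only, restate. SymplecticPurityBound
refuted → the frame consequence goes, the flatness theorems stand as arithmetic. X proved anywhere →
¬S, moot.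

NOT DECOMPOSED YET. The mid-band split (runs vs scattered supports); the Weil fact (wi-20042, not an
item); explicit δ(η); the all-primes stabilizer-fidelity
refinement; decision-diagram and circuit-level bookkeeping (card P2/K3); cubic vs quadratic χ (no
difference expected); composite moduli;
existence/density of qualifying primes in the window (Huxley-range PNT + counting sparse
representations, θ ≤ 0.15) — meaning, not logic.

CHEAPEST FALSIFIER. kit, minutes–hours: census of E(p) = log_p max_(a≠0,b) |S'(a,b)| by FWHT per
shift for all primes p < 2^13 and all STRUCTURED primes
p = 2^n−2^j±1, 2^n±2^i±2^j±1, Mersenne/Fermat-type up to 2^16 (planner, pure python n ≤ 12: E =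
0.81, 0.80, 0.77, 0.76; flat in the weight
of a): E(p) creeping to 1 on a structured family kills XorCharFlat; also scan for EXACT identities
χ(x⊕a) = ±χ(x)(−1)^(b·x) (found at
p = 23, (a,b) = (2,8), 20/20 terms — accident or family?). Literature: is Σ_(u∈U,v∈V)
χ(u+v)χ̄(σ−u+v) for complementary binary cubes in
Shkredov/Volostnov/Chang-type work on character sums over structured sets? (searchd/OpenAlex down
this session.)

NUMBERS. λ_L = log₂(A_L)/L: A₁ = √2 (λ₁ = 1/2, no saving), A₂ = √(2+√2) = 1.84776 (λ₂ = 0.44289,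
exact), A₃ ≈ 2.4467 (λ₃ ≈ 0.430, grid), A₄ ≈ 3.22
(λ₄ ≈ 0.422, grid); Thue–Morse Fouvry–Mauduit value ≈ 0.4033 for comparison. DES17 Thm 16: k <
(1/2−ε)n prescribed bits, saving p^(−δ).
Data (folder compute/, FWHT per shift, quadratic and cubic χ): max |S'|: p^0.81 (n=9), p^0.80
(n=10), p^0.77–0.78 (n=11), p^0.764 (4093),
p^0.772 (3583 = 2^12−2^9−1); CharWalshFlat true size p^0.72 (2039) → p^0.644 (262139). Resonant
coefficients: |S| = 126/126 (p=127, a=1^7),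
130 (p=223, a=p, b=32), 282 (p=509, a=p, b=2), 534 (p=1021, a=p), 1050 (p=2039, a=p) — all at a = p,
b ≼ NOT p. Items at open: 9
(1 target, 4 cruxes, 3 support, 1 assembly).

DEFINITION REQUESTS. None (MulChar, ZMod, Nat.xor/testBit/ofBits, pauliString, QReg, normSq exist;
`lean check` rc 0 on all nine items). CITE FACT WANTED (filed as wi-20042): Weil's bound for
multiplicative character sums of polynomials / rational functions over F_p — |Σ_x χ(f(x))| ≤ (m−1)√p
for χ
of order ℓ and f with m distinct roots not an ℓ-th power (Schmidt1976 Ch. II Thm 2C';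
IwaniecKowalski2004 §11.7; Weil1948) — needed by
OffbandXorCharFlat; also useful to MobiusLadder / ArithStatLadder / SymplecticPurity.DlogGraphFlat.

Novelty: Searches (2026-08-15): lit search --source zbmath "Legendre sequence Walsh transform" (15, noise),
"Thue-Morse sequence Dirichlet character sum" (0), "sum of digits character sums finite fields" (4:
Dartyge–Sárközy 2013, DMS 2015, Swaenepoel 2018, Mattheus 2019), "nonlinearity Boolean functions
Legendre symbol" (1: Aly–Winterhof 2011), "prescribing binary digits quadratic residues" (1: DES17),
"character sums binary digits" (5: incl. Ostafe–Shparlinski 2012), "sumsets contained in roots of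
unity" (1: Hanson–Petridis 2021); --source arxiv "Paley graph clique number character sums" (2:
arXiv:2303.16475, 2301.07021), "Legendre symbol XOR" (0), "stabilizer entropy maximal magic states
construction" (1: Haug–Piroli 2022); lit galaxy search "Legendre symbol Walsh" --star all (0),
galaxy pdf bm25 'character sums Thue–Morse / Walsh' (15, noise); lit read arXiv:1601.04754 (Thm 16,
Lemma 2, Cor 3), arXiv:2010.13817 (§2, §4 f_W bound, §7 'explicit constructions … still wide open');
lit frontier QuantumAdvantage --since 2022 (30 rows, none relevant); lean search (no
Weil/Kloosterman/Burgess bound in Mathlib or Literature; pauliString/stabilizerStates exist); read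
sibling routes PauliFlat, KummerSector, SymplecticPurity (opened 14:32Z, same day). searchd
(local/hybrid) rc 75 and OpenAlex HTTP 429 all session — logged; refuter please re-run 'XOR shift
autocorrelation Legendre', 'character sums Hilbert cube complementary digits', 'magic of quadratic
residue states'.
Nearest prior art found:  [refs: 10.1090/tran/6903, 10.4007/annals.2010.171.1591, 10.1112/plms.12322, 2303.16475, 1601.04754, 2010.13817, doi:10.1090/tran/6903, doi:10.4007/annals.2010.171.1591, doi:10.1112/plms.12322, MauduitRivat2015]

Barriers (technique_class: simulation-lower-bound, character-sums, digits): - technique_class: simulation-lower-bound, character-sums, digits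
- Literature.Barriers.QuantumAdvantage.Relativization: not engaged — every item is an explicit
character sum over F_p or a statement about one explicit state family; oracles have no digits; the
negative target X is shared with Dequantize/PauliFlat/SymplecticPurity and nothing here argues for
X.
- Literature.Barriers.QuantumAdvantage.Algebrization: same verdict (no oracle-inclusion or
arithmetization argument).
- Literature.Barriers.QuantumAdvantage.NaturalProofs: n/a — flatness of ONE explicit state family,
no constructive dense property used against P/poly, no circuit lower bound claimed.
- Literature.Barriers.QuantumAdvantage.NoiseThresholdUpperBounds: n/a (noiseless witness state;
adjacent only, as for PauliFlat); same for the uncatalogued companion files UncorrectedNoise,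
BoundedEntanglement (Jozsa–Linden: consistent and sharpened — CharStateFlat + SymplecticPurityBound
say the vDS data state is not made low-Schmidt-rank by any Clifford re-framing; nothing to evade,
¬S-side engine), TensorNetworkContraction (treewidth: orthogonal parameter, consistent with
Markov–Shi) and LinearXEBSpoofing (n/a).
- Literature.Barriers.QuantumAdvantage.SeparationPrerequisites: n/a — no class separation is claimed
(negative-side kill route).
- Literature.Barriers.QuantumAdvantage.TotalFunctionSpeedupLimit: n/a — white-box arithmetic state,
no query argument.
- Literature.Barriers.QuantumAdvantage.PPolyOracles: n/a (no advice/

Novelty grade: new-combination — ROUTE REVIEW grade (refuter rreview-0815T14-7-g3, 2026-08-15; REVIEW-XorDarkCharacters-g3.md on the route; item-level review by refuter-rreview-0815T14-9-0 stands, no statement changed since). new-combination: (Karatsuba bilinear method / DES prescribed-binary-digit character sums + Weil, transplant (refuter refuter-rreview-0815T14-7-g3-0, 2026-08-15T17:16:13Z; prior: DietmannElsholtzShparlinski2016/17 Thm 16, Lemma 2 (arXiv:1601.04754, doi:10.1090/tran/6903), MauduitRivat2010 (doi:10.4007/annals.2010.171.1591), MauduitRivat2015, Gelfond1968, Hegyvári–Sárközy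 (Hilbert cubes avoiding non-residues); Hegyvári 2016 doi:10.1016/j.jnt.2015.09.016, Alsetri–Shao 2022 doi:10.1007/s00013-021-01672-3, Shparlinski 2022 arXiv:2201.00585 = doi:10.1137/22m1470396 (read pp.3-4)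

History (route lifecycle, newest last):
- 2026-08-16T04:15:24Z · AUTO-CRUX (backfill): XdcThesis — hypotheses of the deciding theorem that nothing in the route derives are cruxes (operator:999:1085951)
- 2026-08-26T14:16:46Z · DORMANT — reconciler: no traction for 6.7 d (last activity item-proof-filed at 2026-08-19T20:56:36Z); parked, not closed — `ledger route dormant route-QuantumAdvantage-Xo (operator:999:1594387)

sub-problem: QuantumAdvantage · status: dormant · opened planner-plancard-QuantumAdvantage-QuantumAdva-6f0b7768-0 2026-08-15T14:42:31Z · rev 5 · ledger route-QuantumAdvantage-XorDarkCharacters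
GENERATED by the gate from the ledger (D-0016/17). Provers cite these decls: `theorem foo : Summit.QuantumAdvantage.QuantumAdvantage.Theses.XorDarkCharacters.<Decl> := …` in Summits/QuantumAdvantage/QuantumAdvantage/Theorems/<Name>.lean.
-/

namespace Summit.QuantumAdvantage.QuantumAdvantage.Theses.XorDarkCharacters

open scoped BigOperators Topology Manifold Classical MeasureTheory ProbabilityTheory Matrix InnerProductSpace ComplexConjugate ContinuousMap
open Filter Set Function TopologicalSpace MeasureTheory

attribute [summit_statement] _root_.QuantumAdvantage

open Literature.QuantumAdvantage

/-- item stmt-QuantumAdvantage-0242 · crux (kind.auto-crux: conjecture-grade) · rank 0 · open · by planner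
why it might fail: X puts FACTORING in BPP (Shor) and contradicts the oracle evidence BQP^O ⊄ BPP^O; nobody expects it — the route exists for the kills.
sources: BernsteinVazirani1997, vanDamSeroussi2002, arXiv:2412.17209
Thesis X of route Dequantize, targeting ¬QuantumAdvantage (quantum-advantage.S02, BQP = BPP): every
uniform Clifford+T family with error 1/3 is simulable in BPP. [BernsteinVazirani1997 §8;
BravyiGosset2016] -/
@[route_item "route-QuantumAdvantage-XorDarkCharacters", crux]
def XdcThesis : Prop :=
  Literature.Computability.Cryptography.BQP ⊆ Literature.Computability.Complexity.BPP

/-- item stmt-QuantumAdvantage-9867 · crux · rank 2 · open · by planner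
why it might fail: Mid band |a|≈n/2 = bilinear sum over two complementary binary cubes ≈√p each: Paley-graph-conjecture range, open even for χ(a+b) (arXiv:1606.00358 §1); cubes have doubling 3^dim, so Chang/Volostnov–Shkredov fail; data only n≤12; a structured (p,a) family with x⊕a ≡ ux+d on 2^(n−o(n)) points kills it
sources: DietmannElsholtzShparlinski2016, arXiv:1606.00358, HansonPetridis2020, arXiv:2303.16475, Schmidt1976, vanDamSeroussi2002
[crux] CORRECTED CONJECTURE C' (the one new sum). ∃ δ > 0, p₀ such that for every prime p ≥ p₀ with
2^(n−1) < p < 2^n, every nontrivial multiplicative character χ mod p, every shift 0 < a < 2^n and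
every Walsh mask b < 2^n: |Σ_(x<p, x⊕a<p, x+(x⊕a)≢0 (p)) χ(x) χ̄(x⊕a) (−1)^(b·x)| ≤ p^(1−δ) — the
XOR-autocorrelation of χ, twisted by any Walsh character, saves a power once the resonant cells (x⊕a
≡ −x, summand ≡ χ̄(−1)) are removed. Off-band weights are OffbandXorCharFlat (theorem mod Weil); the
content is the MID BAND |a| = n/2 ± ηn: Σ_(s∈2U+c,t∈2V+c') a_s b_t χ(t+s)χ̄(t−s) over complementary
binary cubes U, V of size ≈ √p. [difficulty: open-problem] -/
@[route_item "route-QuantumAdvantage-XorDarkCharacters", crux]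
def XorCharFlat : Prop :=
  ∃ δ : ℝ, 0 < δ ∧ ∃ p₀ : ℕ, ∀ p : ℕ, p₀ ≤ p → p.Prime → ∀ n : ℕ, 2 ^ (n - 1) < p → p < 2 ^ n → ∀ χ : MulChar (ZMod p) ℂ, χ ≠ 1 → ∀ a b : ℕ, 0 < a → a < 2 ^ n → b < 2 ^ n → ‖∑ x ∈ Finset.range p, (if x ^^^ a < p ∧ (x + (x ^^^ a)) % p ≠ 0 then χ (x : ZMod p) * starRingEnd ℂ (χ ((x ^^^ a : ℕ) : ZMod p)) * (∏ i ∈ Finset.range n, (if b.testBit i ∧ x.testBit i then (-1 : ℂ) else 1)) else 0)‖ ≤ (p : ℝ) ^ ((1 : ℝ) - δ)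

/-- item stmt-QuantumAdvantage-9868 · crux · rank 3 · open · by planner
why it might fail: Not in print (DES Thm 16 = prescribed digits, no XOR shifts): the degenerate-tuple count (matchings under u ↦ a−u) or the O(n²) dyadic range decomposition could leak 2^Ω(n) near |a| ≈ (1/2±η)n, breaking the ∀η>0 claim for the method; δ ~ η²/ν; Lean closure hostage to Weil (wi-20042, not in Mathlib).
sources: DietmannElsholtzShparlinski2016, arXiv:1601.04754, Schmidt1976, IwaniecKowalski2004, Weil1948, KaratsubaVoronin1992
[crux] The off-band theorem: for every η > 0 there are δ > 0, p₀ with the bound of XorCharFlat for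
all shifts a of Hamming weight ≤ (1/2−η)n or ≥ (1/2+η)n. PROOF PLAN (planner NOTES §6): nested
dyadic decomposition of the two range conditions into O(n²) sub-cubes; in each, x = H+u+v, x⊕a =
H'+(σ−u)+v with u on supp(a), v off it; Hölder (2ν-th moment) over the cube of size ≥ p^(1/2+η/2),
inner cube ≥ p^(η/2ν) (tiny weights: 2^|a| cells of additive-shift correlations, Karatsuba again
inside each cell); Weil for Σ_v χ(R(v)), deg R ≤ 4ν; degenerate tuples ≤ C_ν·(#U)^ν via the link
graph (each variable's two roots must be matched by another variable's; cross-matches are the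
resonance congruences u_i+u_j ≡ R with ≤ 3 partners); resonant x = at most 2 excluded values of v,
product structure kept. THEOREM MODULO WEIL: Lean closure needs Weil's bound for multiplicative
character sums of polynomials (Schmidt1976 II.2C'), requested as Literature cite fact wi-20042 —
provers should block on that fact (blocked-on), not re-derive RH for curves here. [difficulty: L] -/
@[route_item "route-QuantumAdvantage-XorDarkCharacters", crux]
def OffbandXorCharFlat : Prop :=
  ∀ η : ℝ, 0 < η → ∃ δ : ℝ, 0 < δ ∧ ∃ p₀ : ℕ, ∀ p : ℕ, p₀ ≤ p → p.Prime → ∀ n : ℕ, 2 ^ (n - 1) < p → p < 2 ^ n → ∀ χ : MulChar (ZMod p) ℂ, χ ≠ 1 → ∀ a b : ℕ, 0 < a → a < 2 ^ n → b < 2 ^ n → ((((Finset.range n).filter fun i => a.testBit i).card : ℝ) ≤ (1 / 2 - η) * n ∨ (1 / 2 + η) * n ≤ (((Finset.range n).filter fun i => a.testBit i).card : ℝ)) → ‖∑ x ∈ Finset.range p, (if x ^^^ a < p ∧ (x + (x ^^^ a)) % p ≠ 0 then χ (x : ZMod p) * starRingEnd ℂ (χ ((x ^^^ a : ℕ) :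 ZMod p)) * (∏ i ∈ Finset.range n, (if b.testBit i ∧ x.testBit i then (-1 : ℂ) else 1)) else 0)‖ ≤ (p : ℝ) ^ ((1 : ℝ) - δ)

/-- item stmt-QuantumAdvantage-9870 · crux · rank 5 · open · by planner
why it might fail: Open with the same content as XorCharFlat at qualifying primes (a Pauli string with |⟨S⟩| ≥ p^(−o(1))·‖ψ‖² there IS a mid-band XOR-autocorrelation counterexample) plus typing risk: pauliString Y-phase/normSq conventions, the window and the k ≤ 5 resonance range are the planner's, unverified.
sources: arXiv:2412.17209, arXiv:2410.09001, BravyiEtAl2019, LiuWinter2022, route-QuantumAdvantage-SymplecticPurity item SymplecticPurityBound, vanDamSeroussi2002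
[crux] THE INTERFACE TO THE KILL (follows from XorCharFlat via FlatOfXorFlat; typed to match the
ε-flat hypothesis of SymplecticPurity.SymplecticPurityBound): for every θ > 0 there are δ > 0, p₀
such that for every prime p ≥ p₀ in the window 2^n − 2^((1−θ)n) ≤ p < 2^n (range bias ≤ 2^(1−θn))
whose resonance numbers kp − (2^n−1), k = 1..5, admit NO {0,±1}-digit representation Σ_A 2^j − Σ_B
2^j of weight |A|+|B| < θn (off the sparse-representation locus, cf. DlogGraphFlat's NAF
hypothesis), every nontrivial χ and every Pauli string S ≠ I: |⟨ψ_χ|S|ψ_χ⟩| ≤ p^(−δ)·‖ψ_χ‖², ψ_χ(x)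
= χ(ofBits x)·[ofBits x < p]. Consequences by name: SymplecticPurityBound ⇒ Schmidt rank ≥ p^δ/4 at
some bond of every T-free Clifford frame with stabilizer ancillas (CAMPS / stabilizer-TN kill on the
Gauss-sum witness); stabilizer fidelity ≤ p^(−δ) + 2^(−n). Honest scale: flatness methods cap at ε ≈
2^(−n/2) (LiuWinter §4: explicit states certified beyond that are open); δ here is whatever
XorCharFlat gives. [deps: XorCharFlat] [difficulty: M] -/
@[route_item "route-QuantumAdvantage-XorDarkCharacters", crux]
def CharStateFlat : Prop :=
  ∀ θ : ℝ, 0 < θ → ∃ δ : ℝ, 0 < δ ∧ ∃ p₀ : ℕ, ∀ p : ℕ, p₀ ≤ p → p.Prime → ∀ n : ℕ, p < 2 ^ n → (2 : ℝ) ^ n - (2 : ℝ) ^ ((1 - θ) * n) ≤ p → (∀ k ∈ Finset.Icc 1 5, ∀ A ∈ (Finset.range n).powerset, ∀ B ∈ (Finset.range n).powerset, Disjoint A B → (∑ j ∈ A, (2 : ℤ) ^ j) - (∑ j ∈ B, (2 : ℤ) ^ j) = k * p - (2 ^ n - 1) → θ * n ≤ (A.card + B.card : ℝ)) → ∀ χ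 : MulChar (ZMod p) ℂ, χ ≠ 1 → ∀ S : Fin n → Literature.Computability.QuantumComplexity.Pauli, S ≠ (fun _ => Literature.Computability.QuantumComplexity.Pauli.I) → ‖star (fun x : Literature.Computability.Cryptography.QReg n => if Nat.ofBits x < p then χ ((Nat.ofBits x : ℕ) : ZMod p) else 0) ⬝ᵥ (Literature.Computability.QuantumComplexity.pauliString S).mulVec (fun x : Literature.Computability.Cryptography.QReg n => if Nat.ofBits x < p then χ ((Nat.ofBits x : ℕ) : ZMod p) else 0)‖ ≤ (p : ℝ) ^ (-δ) * Literature.Computability.Cryptography.normSq (fun x : Literature.Computability.Cryptography.QReg n => if Nat.ofBits x < p then χ ((Nat.ofBits x : ℕ) : ZMod p) else 0)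

/-- item stmt-QuantumAdvantage-9869 · support · rank 4 · open · by planner
why it might fail: Only via the constants as typed: the Gallagher step and the spoiled-block bound for ‖G'‖₁ are the planner's reconstruction (giving 9·n·√p·(2+√2)^((n−1)/4); 16 is slack); the exponent is exact. Trivially true for p < 2^150, so numerics cannot probe it.
sources: MauduitRivat2010, MauduitRivat2015, Gelfond1968, Bourgain2013Walsh, Gallagher1970, DietmannElsholtzShparlinski2016
[crux] Card T1 with the exact constant (PROVABLE NOW): for every prime p with 2^(n−1) < p < 2^n,
nontrivial χ mod p and mask b < 2^n, |Σ_(x<p) χ(x)(−1)^(b·x)| ≤ 16·n·√p·(2+√2)^(n/4) = O(n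
p^(1/2+λ₂)), λ₂ = log₂(2+√2)/4 = 0.4429: every Hadamard-basis amplitude of |χ⟩ is ≤ p^(−0.057+o(1)),
i.e. the overlap of |χ⟩ with the 2^n product stabilizer states H^⊗n|b⟩ is unconditionally small (the
product sector of stabilizer fidelity; the same L¹ constant covers i^(l·x) phases). Proof: dyadic
blocks of [0,p) (on a block the Walsh weight is ± a completely 2-multiplicative function of the low
bits); completion χ(m) = τ(χ̄)^(−1) Σ_t χ̄(t) e(mt/p) (Mathlib gaussSum, |τ|² = p); Gallagher's
pointwise Sobolev inequality Σ_t |G(t/p)| ≤ p‖G‖₁ + ½‖G'‖₁ (FTC); product rule for G' (no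
Bernstein); L¹ block-submultiplicativity ‖Π_(j<k) 2|cos π(2^jθ+η_j)|‖₁ ≤ 2·A₂^⌊k/2⌋ by θ = (m+φ)/4;
A₂ := sup_η ¼Σ_(m<4) Π_(j<2) 2|cos π(2^(j−2)m+η_j)| = √(2+√2) = 2cos(π/8) EXACTLY (fix η₀: sup_η₁ of
a|cos|+b|sin| = √(a²+b²), a²+b² = 2+|sin 2πη₀|+|cos 2πη₀| ≤ 2+√2). [difficulty: provable-now] -/
@[route_item "route-QuantumAdvantage-XorDarkCharacters", crux]
def CharWalshFlat : Prop :=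
  ∀ p n : ℕ, p.Prime → 2 ^ (n - 1) < p → p < 2 ^ n → ∀ χ : MulChar (ZMod p) ℂ, χ ≠ 1 → ∀ b : ℕ, b < 2 ^ n → ‖∑ x ∈ Finset.range p, χ (x : ZMod p) * (∏ i ∈ Finset.range n, (if b.testBit i ∧ x.testBit i then (-1 : ℂ) else 1))‖ ≤ 16 * n * Real.sqrt p * (2 + Real.sqrt 2) ^ ((n : ℝ) / 4)

/-- item stmt-QuantumAdvantage-9871 · support · rank 9 · closed · proved by Summit.QuantumAdvantage.QuantumAdvantage.Theorems.ZSectorRange.zSectorRange_proof @ af111773514e (prover) · by planner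
sources: elementary, planner NOTES.md §audit 3
[support] The a = 0 sector is the Walsh spectrum of the range [1,p): for 0 < b < 2^n and p ≤ 2^n,
|Σ_(0<x<p) (−1)^(b·x)| ≤ 2^n − p + 1 (the full cube sums to 0; the complement [p,2^n) and x = 0 are
the error). Provable now (one line after Finset.sum over the cube); in the window it is ≤ 2^((1−θ)n)
+ 1. [difficulty: provable-now] -/
@[route_item "route-QuantumAdvantage-XorDarkCharacters", crux]
def ZSectorRange : Prop :=
  ∀ p n b : ℕ, p ≤ 2 ^ n → 0 < b → b < 2 ^ n → |∑ x ∈ Finset.Ico 1 p, (∏ i ∈ Finset.range n, (if b.testBit i ∧ x.testBit i then (-1 : ℝ) else 1))| ≤ (2 ^ n - p + 1 : ℝ)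

-- `ZSectorRange` holds: proved by `Summit.QuantumAdvantage.QuantumAdvantage.Theorems.ZSectorRange.zSectorRange_proof` @ af111773514e (its module imports this route file, so no `_holds` link can be stated here).

/-- item stmt-QuantumAdvantage-9872 · support · rank 9 · closed · proved by Summit.QuantumAdvantage.QuantumAdvantage.Theorems.ResonantCells.resonantCells_proof @ b32314ee04d2 (prover) · by planner
sources: elementary, planner NOTES.md §audit 2, route-QuantumAdvantage-SymplecticPurity item DlogGraphFlat (same NAF phenomenon for g^x)
[support] (i) the identity x + (x⊕a) = a + 2·(x ∧ ā) for x, a < 2^n, ā = (2^n−1)⊕a; (ii) hence the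
resonant x (0 < x < p, x⊕a < p, x + (x⊕a) ≡ 0 mod p) have x ∧ ā determined mod p (≤ 2 values), so
there are at most 2·2^(popcount a) of them — and each value w = x∧ā solves 2w − ā·… i.e. is a
signed-binary representation of kp − (2^n−1) supported on ā. Provable now (checked exhaustively for
all a, p ≤ 2039). [difficulty: provable-now] -/
@[route_item "route-QuantumAdvantage-XorDarkCharacters", crux]
def ResonantCells : Prop :=
  (∀ n x a : ℕ, x < 2 ^ n → a < 2 ^ n → x + (x ^^^ a) = a + 2 * (x &&& ((2 ^ n - 1) ^^^ a))) ∧ ∀ p n a : ℕ, 2 ^ (n - 1) < p → p < 2 ^ n → 0 < a → a < 2 ^ n → ((Finset.range p).filter fun x => 0 < x ∧ x ^^^ a < p ∧ (x + (x ^^^ a)) % p = 0).card ≤ 2 * 2 ^ ((Finset.range n).filter fun i => a.testBit i).card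

-- `ResonantCells` holds: proved by `Summit.QuantumAdvantage.QuantumAdvantage.Theorems.ResonantCells.resonantCells_proof` @ b32314ee04d2 (its module imports this route file, so no `_holds` link can be stated here).

/-- item stmt-QuantumAdvantage-9873 · support · rank 9 · open · by planner
sources: KempeEtAl2010, AaronsonGottesman2004, planner NOTES.md §6
[support] Glue of the interface: XorCharFlat → ZSectorRange → ResonantCells → CharStateFlat. Proof:
pauliString S|x⟩ = (phase_S(x))|x⊕a⟩ with |phase| = 1 and sign (−1)^(b·x) (b = Z/Y positions, a =
X/Y positions), so |⟨ψ|S|ψ⟩| = |Σ_x ψ(x) conj ψ(x⊕a) (−1)^(b·x)|; for a = 0 use ZSectorRange and the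
window; for a ≠ 0 split off the resonant x (ResonantCells: ≤ 2·2^|a| = 2·2^(n−|ā|) ≤ 2·2^((1−θ)n)
since ā carries a signed representation of some kp − (2^n−1), hence |ā| ≥ θn by hypothesis) and
bound the rest by XorCharFlat; ‖ψ‖² = p − 1. [difficulty: provable-now] -/
@[route_item "route-QuantumAdvantage-XorDarkCharacters", crux]
def FlatOfXorFlat : Prop :=
  XorCharFlat → ZSectorRange → ResonantCells → CharStateFlat

/-- item stmt-QuantumAdvantage-9874 · assembly · rank 1 · closed · proved by Summit.QuantumAdvantage.QuantumAdvantage.Theorems.XorDarkCharacters.Assembly_proof @ 225e34940813 (prover) · by planner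
sources: BernsteinVazirani1997
[assembly] XdcThesis → ¬ QuantumAdvantage. -/
@[route_item "route-QuantumAdvantage-XorDarkCharacters", crux]
def Assembly : Prop :=
  XdcThesis → ¬ QuantumAdvantage

-- `Assembly` holds: proved by `Summit.QuantumAdvantage.QuantumAdvantage.Theorems.XorDarkCharacters.Assembly_proof` @ 225e34940813 (its module imports this route file, so no `_holds` link can be stated here).

/-! D-0027 §2.1 — DECIDING THEOREM (planner-authored via `route open/edit --closes-file`; by planner-rrepair-QuantumAdvantage-XorDarkCharac-2b4c0a71-g3-0 2026-08-15T17:44:25Z):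
its hypotheses are this route's items and its conclusion the sub-problem Statement (glue_lint), and it elaborates with this file. -/

@[closes "route-QuantumAdvantage-XorDarkCharacters"] theorem closes (hThesis : XdcThesis) (_hXorFlat : XorCharFlat) (_hOffband : OffbandXorCharFlat) (_hWalsh : CharWalshFlat) (_hState : CharStateFlat) (_hZSector : ZSectorRange) (_hResonant : ResonantCells) (_hInterface : FlatOfXorFlat) (_hAssembly : Assembly) : ¬ _root_.QuantumAdvantage :=
  fun hQA => Exists.elim hQA fun _L hL => absurd (hThesis hL.1) hL.2

end Summit.QuantumAdvantage.QuantumAdvantage.Theses.XorDarkCharacters
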